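import Summits.ResolutionOfSingularities.ResolutionOfSingularities.Theorems.EquisingularLiftEquisingularLiftNatNDInvariantsP
import HarnessLib

/-!
# [OURS · L1 W4.5(b) · EL♮(3)] ND ROUND-LEVEL PROPS, POINTWISE VARIANT — `…NatNDRoundPropsP` ((L-1b); the six `₀` statements over (L-1a) ✓ `…NatNDInvariantsP`) (desk R36 (α) «(K-reg) = (i) LOCALISE, strong form L0» + R36′ (1) suffix `P`;
# WIDTH TABLE D2 hand (L-1) = the PORT; INVARIANT FREEZE 2)

OURS · L1 W4.5(b) · EL♮(3) stmt-ResolutionOfSingularities-20148 (parent EL♮ stmt-…-20038) · counted 0 · AI-written (res-L1-w45b-idea-1 g23 SPEC K6 §P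
`Cruxes/EquisingularLiftNatThree/NDLeavesRungK6Loc.lean` sha16 9899f83d0e925ade — the `…P` / `…₀` declarations VERBATIM; ported to the tree by the text owner res-L1-w45b-lead-2 g7),
weaker than expert review; nothing of [Hironaka2017] asserted; no statement of the manuscript.  Definitions + PROVED pure plumbing only (no `sorry`, no instance, no
notation; standard axioms).  CONTENT: the downstairs ND invariant of ✓ p639684 / ✓ p643982 WITHOUT its global clause `Scheme.IsRegular F` — `ND.NDInvP` (= `ND.NDInv`
minus conjunct 1), `ND.NDInvCP` (+ `IsClosed T`), `ND.NDInvCLNP` (+ `IsLocallyNoetherian F`), the projection `ND.ndInvCLNP_of_ndInvCLN`, the END at measure 0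
`ND.ndInvCLNP_end` (proof of `ndInv_end` verbatim — clause 1 was never used); THIS FILE ((L-1b), desk 16:29:01Z + D2 UPDATE 16:31:10Z): the six ROUND-LEVEL statements `ND.RoundAtNDFrameLN₀`, `ND.TransportRoundLN₀`, `ND.TransportInit₀`, `ND.TransportStep₀`, `ND.TransportEnd₀`, `ND.NDInvPersists₀` = the tree Props of ✓ p643982 `…NatNDRoundModelSplit` l.150/169/241/272/305 and ✓ p639684 `…NatNDInvariants` l.307 with EXACTLY the ambient binder `IsRegular F₁ →` / `IsRegular F₉ →` and the conjunct `IsRegular F₉ ∧` (End: `IsRegular F ∧`) DELETED and `NDInv ↦ NDInvP`, NOTHING added (panel deletion-only token reads: crit-2 l.82108, crit-3 l.82115 PASS); names AS TYPED by the SPEC owner (`…₀`), module ASCII `…P`.  WHY (three concordant audits,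
desk R36 (α)): the ambient regularity is consumed only pointwise at the round point (supplied by the frame data, `ND.IsNDFrameAt` = an r.s.p.), re-emitted only to
feed itself, and discarded by `ndInv_end`; the A⁗-prefix customers of the ND-LEAVES programme (R33 (β)) end at k-stages that are NOT globally regular.  RULE (desk):
NEW FILES ONLY — the landed chain (✓ p639684 … ✓ p647090, the 35th) stays untouched; every D2 brick ((L-R0)/(L-β0)/(L-β1)/(L-β2)/(L-δ)/(L-ℓ)/(L-Ω)) is stated BY NAME
against THESE declarations (namespace `…Sections.ND`, names = the spec's).  `--supports stmt-ResolutionOfSingularities-20148 --as helper`.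
-/

set_option linter.dupNamespace false
set_option linter.overlappingInstances false -- K5′-style signatures carry `[IsDomain O] [IsDiscreteValuationRing O]`

noncomputable section

open CategoryTheory CategoryTheory.Limits AlgebraicGeometry TopologicalSpace Topology IsLocalRing
open MvPolynomial
open Literature.AlgebraicGeometry.Resolution
open AlgebraicGeometry.Scheme.IdealSheafData

namespace Summit.ResolutionOfSingularities.ResolutionOfSingularities.Cruxes.EquisingularLiftNat.Sections.ND

open Summit.ResolutionOfSingularities.ResolutionOfSingularities.Cruxes.EquisingularLiftNat.Sections

section L0

variable (n : ℕ) (k : Type) [Field k]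

/-- **`RoundAtNDFrameLN₀ n k`** = the port's `RoundAtNDFrameLN` (✓ p643982 l.150) with `IsRegular F₁ →` and `IsRegular F₉ ∧` DELETED (token-identical otherwise).
[OURS · L1 W4.5b · statement (Prop)] -/
def RoundAtNDFrameLN₀ : Prop :=
  ∀ (F₁ : AlgebraicGeometry.Scheme.{0}) (ρ : F₁ ⟶ (Literature.AlgebraicGeometry.Motives.projectiveSpace n k).left) (T₁ : Set F₁),
    IsLocallyNoetherian F₁ → IsClosed T₁ →
    ∀ (x : F₁) (hx : IsClosed ({x} : Set F₁)) (W : Fin n → F₁.IdealSheafData), IsNDFrameAt n k ρ T₁ W x →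
    ∀ (F₂ : AlgebraicGeometry.Scheme.{0}) (υ : F₂ ⟶ F₁),
      Literature.AlgebraicGeometry.Resolution.IsBlowup υ
        (AlgebraicGeometry.Scheme.IdealSheafData.vanishingIdeal (⟨{x}, hx⟩ : TopologicalSpace.Closeds F₁)) →
      ∃ (F₉ : AlgebraicGeometry.Scheme.{0}) (β : F₉ ⟶ F₂) (T₉ : Set F₉),
        StrataTower F₂ ((frameBoundary W).stepAlong
            (AlgebraicGeometry.Scheme.IdealSheafData.vanishingIdeal (⟨{x}, hx⟩ : TopologicalSpace.Closeds F₁)) 1 υ)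
          (closure (υ ⁻¹' (T₁ \ {x}))) F₉ β T₉ ∧
        IsLocallyNoetherian F₉ ∧ IsClosed T₉ ∧
        (∀ z : ↥(AlgebraicGeometry.Scheme.IdealSheafData.vanishingIdeal (⟨closure T₉, isClosed_closure⟩ : TopologicalSpace.Closeds F₉)).subscheme, ((AlgebraicGeometry.Scheme.IdealSheafData.vanishingIdeal (⟨closure T₉, isClosed_closure⟩ : TopologicalSpace.Closeds F₉)).subschemeι z : F₉) ∈ (β ≫ υ) ⁻¹' {x} →
          IsRegularLocalRing ((AlgebraicGeometry.Scheme.IdealSheafData.vanishingIdeal (⟨closure T₉, isClosed_closure⟩ : TopologicalSpace.Closeds F₉)).subscheme.presheaf.stalk z)) ∧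
        CategoryTheory.IsIso ((β ≫ υ) ∣_ (⟨{x}ᶜ, hx.isOpen_compl⟩ : F₁.Opens)) ∧
        T₉ ∩ (β ≫ υ) ⁻¹' {x}ᶜ = (β ≫ υ) ⁻¹' (T₁ \ {x})

/-- **`TransportRoundLN₀ n k`** = the port's `TransportRoundLN` (l.169) with the same two deletions. [OURS · L1 W4.5b · statement (Prop)] -/
def TransportRoundLN₀ : Prop :=
  ∀ (F₁ : AlgebraicGeometry.Scheme.{0}) (ρ : F₁ ⟶ (Literature.AlgebraicGeometry.Motives.projectiveSpace n k).left) (T₁ : Set F₁),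
    IsLocallyNoetherian F₁ → IsClosed T₁ →
    ∀ (x : F₁) (hx : IsClosed ({x} : Set F₁)) (W : Fin n → F₁.IdealSheafData)
      (w : Fin n → F₁.presheaf.stalk x) (g : MvPolynomial (Fin n) k),
      (∀ j, stalkIdeal (W j) x = Ideal.span {w j}) →
      Ideal.span (Set.range w) = IsLocalRing.maximalIdeal (F₁.presheaf.stalk x) →
      ringKrullDim (F₁.presheaf.stalk x) = (n : WithBot ℕ∞) →
      LocalNDWon g →
      stalkIdeal (AlgebraicGeometry.Scheme.IdealSheafData.vanishingIdeal (⟨closure T₁, isClosed_closure⟩ : TopologicalSpace.Closeds F₁)) x =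
        Ideal.span {MvPolynomial.eval₂ (baseToStalk n k ρ x) w g} →
      ModelRound n k g →
    ∀ (F₂ : AlgebraicGeometry.Scheme.{0}) (υ : F₂ ⟶ F₁),
      Literature.AlgebraicGeometry.Resolution.IsBlowup υ
        (AlgebraicGeometry.Scheme.IdealSheafData.vanishingIdeal (⟨{x}, hx⟩ : TopologicalSpace.Closeds F₁)) →
      ∃ (F₉ : AlgebraicGeometry.Scheme.{0}) (β : F₉ ⟶ F₂) (T₉ : Set F₉),
        StrataTower F₂ ((frameBoundary W).stepAlong
            (AlgebraicGeometry.Scheme.IdealSheafData.vanishingIdeal (⟨{x}, hx⟩ : TopologicalSpace.Closeds F₁)) 1 υ)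
          (closure (υ ⁻¹' (T₁ \ {x}))) F₉ β T₉ ∧
        IsLocallyNoetherian F₉ ∧ IsClosed T₉ ∧
        (∀ z : ↥(AlgebraicGeometry.Scheme.IdealSheafData.vanishingIdeal (⟨closure T₉, isClosed_closure⟩ : TopologicalSpace.Closeds F₉)).subscheme, ((AlgebraicGeometry.Scheme.IdealSheafData.vanishingIdeal (⟨closure T₉, isClosed_closure⟩ : TopologicalSpace.Closeds F₉)).subschemeι z : F₉) ∈ (β ≫ υ) ⁻¹' {x} →
          IsRegularLocalRing ((AlgebraicGeometry.Scheme.IdealSheafData.vanishingIdeal (⟨closure T₉, isClosed_closure⟩ : TopologicalSpace.Closeds F₉)).subscheme.presheaf.stalk z)) ∧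
        CategoryTheory.IsIso ((β ≫ υ) ∣_ (⟨{x}ᶜ, hx.isOpen_compl⟩ : F₁.Opens)) ∧
        T₉ ∩ (β ≫ υ) ⁻¹' {x}ᶜ = (β ≫ υ) ⁻¹' (T₁ \ {x})

/-- **(B4β0₀) `TransportInit₀ n k`** = the port's `TransportInit` (l.241) with `IsRegular F₁ →` DELETED (the landed ✓ p644379 never used it: binder `_hreg` l.337).
[OURS · L1 W4.5b · statement (Prop)] -/
def TransportInit₀ : Prop :=
  ∀ (F₁ : AlgebraicGeometry.Scheme.{0}) (ρ : F₁ ⟶ (Literature.AlgebraicGeometry.Motives.projectiveSpace n k).left) (T₁ : Set F₁),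
    IsLocallyNoetherian F₁ → IsClosed T₁ →
    ∀ (x : F₁) (hx : IsClosed ({x} : Set F₁)) (W : Fin n → F₁.IdealSheafData)
      (w : Fin n → F₁.presheaf.stalk x) (g : MvPolynomial (Fin n) k),
      (∀ j, stalkIdeal (W j) x = Ideal.span {w j}) →
      Ideal.span (Set.range w) = IsLocalRing.maximalIdeal (F₁.presheaf.stalk x) →
      ringKrullDim (F₁.presheaf.stalk x) = (n : WithBot ℕ∞) →
      LocalNDWon g →
      stalkIdeal (AlgebraicGeometry.Scheme.IdealSheafData.vanishingIdeal (⟨closure T₁, isClosed_closure⟩ : TopologicalSpace.Closeds F₁)) x =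
        Ideal.span {MvPolynomial.eval₂ (baseToStalk n k ρ x) w g} →
    ∀ (F₂ : AlgebraicGeometry.Scheme.{0}) (υ : F₂ ⟶ F₁),
      Literature.AlgebraicGeometry.Resolution.IsBlowup υ
        (AlgebraicGeometry.Scheme.IdealSheafData.vanishingIdeal (⟨{x}, hx⟩ : TopologicalSpace.Closeds F₁)) →
    ∀ (A₂ : AlgebraicGeometry.Scheme.{0}) (π₀ : A₂ ⟶ Aff n k),
      Literature.AlgebraicGeometry.Resolution.IsBlowup π₀
        (AlgebraicGeometry.Scheme.IdealSheafData.vanishingIdeal (⟨{affOrigin n k}, isClosed_affOrigin n k⟩ : TopologicalSpace.Closeds (Aff n k))) →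
      FStage n F₁ x hx T₁ F₂ υ
        ((frameBoundary W).stepAlong (AlgebraicGeometry.Scheme.IdealSheafData.vanishingIdeal (⟨{x}, hx⟩ : TopologicalSpace.Closeds F₁)) 1 υ)
        (closure (υ ⁻¹' (T₁ \ {x}))) ∧
      Linked n k F₁ x (frameBaseMap n k ρ x w) F₂ υ
        ((frameBoundary W).stepAlong (AlgebraicGeometry.Scheme.IdealSheafData.vanishingIdeal (⟨{x}, hx⟩ : TopologicalSpace.Closeds F₁)) 1 υ)
        (closure (υ ⁻¹' (T₁ \ {x})))
        A₂ π₀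
        ((frameBoundary (coordHyperplane n k)).stepAlong
          (AlgebraicGeometry.Scheme.IdealSheafData.vanishingIdeal (⟨{affOrigin n k}, isClosed_affOrigin n k⟩ : TopologicalSpace.Closeds (Aff n k))) 1 π₀)
        (closure (π₀ ⁻¹' (PrimeSpectrum.zeroLocus {g} \ {affOrigin n k})))

/-- **(B4β1₀) `TransportStep₀ n k`** = the port's `TransportStep` (l.272) with `IsRegular F₁ →` DELETED (✓ p644680 used it ONCE, l.230 `hreg x`, LOCALLY at the round
point — replaced by R0 from `h2`/`h3`, +2 lines). [OURS · L1 W4.5b · statement (Prop)] -/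
def TransportStep₀ : Prop :=
  ∀ (F₁ : AlgebraicGeometry.Scheme.{0}) (ρ : F₁ ⟶ (Literature.AlgebraicGeometry.Motives.projectiveSpace n k).left) (T₁ : Set F₁),
    IsLocallyNoetherian F₁ → IsClosed T₁ →
    ∀ (x : F₁) (hx : IsClosed ({x} : Set F₁)) (W : Fin n → F₁.IdealSheafData)
      (w : Fin n → F₁.presheaf.stalk x) (g : MvPolynomial (Fin n) k),
      (∀ j, stalkIdeal (W j) x = Ideal.span {w j}) →
      Ideal.span (Set.range w) = IsLocalRing.maximalIdeal (F₁.presheaf.stalk x) →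
      ringKrullDim (F₁.presheaf.stalk x) = (n : WithBot ℕ∞) →
      LocalNDWon g →
      stalkIdeal (AlgebraicGeometry.Scheme.IdealSheafData.vanishingIdeal (⟨closure T₁, isClosed_closure⟩ : TopologicalSpace.Closeds F₁)) x =
        Ideal.span {MvPolynomial.eval₂ (baseToStalk n k ρ x) w g} →
    ∀ (Φ : Finset (Finset (Ray n)))
      (F : AlgebraicGeometry.Scheme.{0}) (φF : F ⟶ F₁) (EF : Boundary n F) (TF : Set F)
      (A : AlgebraicGeometry.Scheme.{0}) (φA : A ⟶ Aff n k) (EA : Boundary n A) (TA : Set A),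
      FStage n F₁ x hx T₁ F φF EF TF → Linked n k F₁ x (frameBaseMap n k ρ x w) F φF EF TF A φA EA TA → ToricStage n k g Φ A φA EA TA →
    ∀ σ ∈ Φ, ∀ τ : Finset (Ray n), τ ⊆ σ → Bad (table g) τ → (∃ ρ ∈ τ, ρ ∉ Set.range (e n)) →
      (∀ σ' ∈ Φ, ¬ τ ⊆ σ' → (∑ ρ ∈ τ, ρ) ∉ σ') →
      ((stratum EA τ).support : Set A) ⊆ TA → ¬ TA ⊆ ((stratum EA τ).support : Set A) →
    ∀ (A' : AlgebraicGeometry.Scheme.{0}) (υA : A' ⟶ A), Literature.AlgebraicGeometry.Resolution.IsBlowup υA (stratum EA τ) →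
      ToricStage n k g (star Φ τ) A' (υA ≫ φA) (EA.stepAlong (stratum EA τ) (∑ ρ ∈ τ, ρ) υA)
        (closure (υA ⁻¹' (TA \ ((stratum EA τ).support : Set A)))) →
      (((stratum EF τ).support : Set F) ⊆ TF ∧ ¬ TF ⊆ ((stratum EF τ).support : Set F)) ∧
      ∀ (F' : AlgebraicGeometry.Scheme.{0}) (υF : F' ⟶ F), Literature.AlgebraicGeometry.Resolution.IsBlowup υF (stratum EF τ) →
        FStage n F₁ x hx T₁ F' (υF ≫ φF) (EF.stepAlong (stratum EF τ) (∑ ρ ∈ τ, ρ) υF)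
          (closure (υF ⁻¹' (TF \ ((stratum EF τ).support : Set F)))) ∧
        Linked n k F₁ x (frameBaseMap n k ρ x w) F' (υF ≫ φF) (EF.stepAlong (stratum EF τ) (∑ ρ ∈ τ, ρ) υF)
          (closure (υF ⁻¹' (TF \ ((stratum EF τ).support : Set F))))
          A' (υA ≫ φA) (EA.stepAlong (stratum EA τ) (∑ ρ ∈ τ, ρ) υA)
          (closure (υA ⁻¹' (TA \ ((stratum EA τ).support : Set A))))

/-- **(B4β2₀) `TransportEnd₀ n k`** = the port's `TransportEnd` (l.305) with `IsRegular F₁ →` DELETED and the conclusion's first conjunct `IsRegular F ∧` DELETED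
(END over `x` only; ✓ p646559's off-`x` branch l.106–108 — the ONLY global consumption in the cone — disappears; crit-3 S-T57's weak conjunct «regular at points over
`x`» is free (l.98–105) but has no consumer downstream — `ndInvPersists` discards it — so it is omitted). [OURS · L1 W4.5b · statement (Prop)] -/
def TransportEnd₀ : Prop :=
  ∀ (F₁ : AlgebraicGeometry.Scheme.{0}) (ρ : F₁ ⟶ (Literature.AlgebraicGeometry.Motives.projectiveSpace n k).left) (T₁ : Set F₁),
    IsLocallyNoetherian F₁ → IsClosed T₁ →
    ∀ (x : F₁) (hx : IsClosed ({x} : Set F₁)) (W : Fin n → F₁.IdealSheafData)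
      (w : Fin n → F₁.presheaf.stalk x) (g : MvPolynomial (Fin n) k),
      (∀ j, stalkIdeal (W j) x = Ideal.span {w j}) →
      Ideal.span (Set.range w) = IsLocalRing.maximalIdeal (F₁.presheaf.stalk x) →
      ringKrullDim (F₁.presheaf.stalk x) = (n : WithBot ℕ∞) →
      LocalNDWon g →
      stalkIdeal (AlgebraicGeometry.Scheme.IdealSheafData.vanishingIdeal (⟨closure T₁, isClosed_closure⟩ : TopologicalSpace.Closeds F₁)) x =
        Ideal.span {MvPolynomial.eval₂ (baseToStalk n k ρ x) w g} →
    ∀ (F : AlgebraicGeometry.Scheme.{0}) (φF : F ⟶ F₁) (EF : Boundary n F) (TF : Set F)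
      (A : AlgebraicGeometry.Scheme.{0}) (φA : A ⟶ Aff n k) (EA : Boundary n A) (TA : Set A),
      FStage n F₁ x hx T₁ F φF EF TF → Linked n k F₁ x (frameBaseMap n k ρ x w) F φF EF TF A φA EA TA →
      (∃ Φ : Finset (Finset (Ray n)), ToricStage n k g Φ A φA EA TA) →
      Literature.AlgebraicGeometry.Resolution.Scheme.IsRegular A →
      (∀ z : ↥(AlgebraicGeometry.Scheme.IdealSheafData.vanishingIdeal (⟨closure TA, isClosed_closure⟩ : TopologicalSpace.Closeds A)).subscheme, ((AlgebraicGeometry.Scheme.IdealSheafData.vanishingIdeal (⟨closure TA, isClosed_closure⟩ : TopologicalSpace.Closeds A)).subschemeι z : A) ∈ φA ⁻¹' {affOrigin n k} →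
        IsRegularLocalRing ((AlgebraicGeometry.Scheme.IdealSheafData.vanishingIdeal (⟨closure TA, isClosed_closure⟩ : TopologicalSpace.Closeds A)).subscheme.presheaf.stalk z)) →
      (∀ z : ↥(AlgebraicGeometry.Scheme.IdealSheafData.vanishingIdeal (⟨closure TF, isClosed_closure⟩ : TopologicalSpace.Closeds F)).subscheme, ((AlgebraicGeometry.Scheme.IdealSheafData.vanishingIdeal (⟨closure TF, isClosed_closure⟩ : TopologicalSpace.Closeds F)).subschemeι z : F) ∈ φF ⁻¹' {x} →
        IsRegularLocalRing ((AlgebraicGeometry.Scheme.IdealSheafData.vanishingIdeal (⟨closure TF, isClosed_closure⟩ : TopologicalSpace.Closeds F)).subscheme.presheaf.stalk z))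

/-- **`NDInvPersists₀ n k`** = ✓ p639684 `NDInvPersists` with `NDInv` ↦ `NDInvP` (twice) and the binder `IsRegular F₉ →` DELETED (token-identical otherwise; the landed
proof ✓ p640760 discards that binder with `_`, audit §(1)). [OURS · L1 W4.5b · statement (Prop)] -/
def NDInvPersists₀ : Prop :=
  ∀ (m : ℕ) (F₁ : AlgebraicGeometry.Scheme.{0}) (ρ : F₁ ⟶ (Literature.AlgebraicGeometry.Motives.projectiveSpace n k).left) (T₁ : Set F₁), NDInvP n k (m + 1) F₁ ρ T₁ →
    ∀ (x : F₁) (hx : IsClosed ({x} : Set F₁)),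
      (∃ z : ↥(AlgebraicGeometry.Scheme.IdealSheafData.vanishingIdeal (⟨closure T₁, isClosed_closure⟩ : TopologicalSpace.Closeds F₁)).subscheme, ((AlgebraicGeometry.Scheme.IdealSheafData.vanishingIdeal (⟨closure T₁, isClosed_closure⟩ : TopologicalSpace.Closeds F₁)).subschemeι z : F₁) = x ∧ ¬ IsRegularLocalRing ((AlgebraicGeometry.Scheme.IdealSheafData.vanishingIdeal (⟨closure T₁, isClosed_closure⟩ : TopologicalSpace.Closeds F₁)).subscheme.presheaf.stalk z)) →
    ∀ (F₂ : AlgebraicGeometry.Scheme.{0}) (υ : F₂ ⟶ F₁),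
      Literature.AlgebraicGeometry.Resolution.IsBlowup υ
        (AlgebraicGeometry.Scheme.IdealSheafData.vanishingIdeal (⟨{x}, hx⟩ : TopologicalSpace.Closeds F₁)) →
    ∀ (F₉ : AlgebraicGeometry.Scheme.{0}) (β : F₉ ⟶ F₂) (T₉ : Set F₉),
      IsClosed T₉ →
      (∀ z : ↥(AlgebraicGeometry.Scheme.IdealSheafData.vanishingIdeal (⟨closure T₉, isClosed_closure⟩ : TopologicalSpace.Closeds F₉)).subscheme, ((AlgebraicGeometry.Scheme.IdealSheafData.vanishingIdeal (⟨closure T₉, isClosed_closure⟩ : TopologicalSpace.Closeds F₉)).subschemeι z : F₉) ∈ (β ≫ υ) ⁻¹' {x} →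
        IsRegularLocalRing ((AlgebraicGeometry.Scheme.IdealSheafData.vanishingIdeal (⟨closure T₉, isClosed_closure⟩ : TopologicalSpace.Closeds F₉)).subscheme.presheaf.stalk z)) →
      CategoryTheory.IsIso ((β ≫ υ) ∣_ (⟨{x}ᶜ, hx.isOpen_compl⟩ : F₁.Opens)) →
      T₉ ∩ (β ≫ υ) ⁻¹' {x}ᶜ = (β ≫ υ) ⁻¹' (T₁ \ {x}) →
      NDInvP n k m F₉ ((β ≫ υ) ≫ ρ) T₉

end L0

end Summit.ResolutionOfSingularities.ResolutionOfSingularities.Cruxes.EquisingularLiftNat.Sections.ND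

end
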